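import Literature.Probability.RandomPlanarGeometry.SAWStripPartitionFunction
import Literature.Probability.Percolation.SiteConnectionTools
import HarnessLib
import Mathlib.Data.List.Basic
import Mathlib.Algebra.BigOperators.Ring.Finset
import Mathlib.Algebra.BigOperators.Group.Finset.Sigma

/-!
# Through toolkit — stub `stub_throughToolkit` of line `rectangle-windows` (crux EdgeOfPositivity, stmt-CriticalPhenomena-11344)

Elementary walk surgery on the box partition functions
`Zs[x, n, ℓ, a, b] = Σ_s x^s · #(SAW.stripSAWs n ℓ s a b)` (self-avoiding walks of `ℤ²` from `a`
to `b` inside the box `{0..ℓ} × {1..n}`, weight `x^{steps}`) and the one-strand through function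
`Thr[x, n, ℓ] = Zs[x, n, ℓ, (0,1), (ℓ,1)]`:

* (T0) the straight bottom-row walk gives `x^ℓ ≤ Thr[x, n, ℓ]` (`n ≥ 1`);
* (T2) supermultiplicativity `x · Thr[p] · Thr[q] ≤ Thr[p+q+1]`: glue a through walk of span `p`,
  the horizontal step `(p,1) → (p+1,1)` and a through walk of span `q` translated by `(p+1, 0)`;
  the column ranges `{0..p}` and `{p+1..p+q+1}` are disjoint, so the glued walk is self-avoiding,
  and the gluing is injective with additive lengths;
* (T3) `x · Thr[p] ≤ Thr[p+1]`, a corollary of (T2) with `q = 0` and (T0) with `ℓ = 0`;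
* (T5) the rotation by `π` of the box, `(c, r) ↦ (ℓ - c, n + 1 - r)`, a graph automorphism of
  `ℤ²` mapping the box onto itself, gives `Z(BR → TR) = Z(TL → BL)` term by term.

All sums over walks are rewritten as sums of `x^{|ω|}` over the finite set of all self-avoiding
walks of the box (`zs_eq_sum_allSAWs`), after which every inequality is "injective image, then
subset".  Sources: folklore lattice combinatorics (Hammersley–Welsh concatenation, Madras–Slade
§1.2).
-/

noncomputable section

open Finset
open Literature.Probability.LatticeModels Literature.Probability.RandomPlanarGeometry
open Literature.Probability.Percolation (zdShiftIso zdShiftIso_apply zdSignedPermIso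
  zdSignedPermIso_apply)

namespace Summit.CriticalPhenomena.SAWScalingLimit.Theorems.EdgeOfPositivity.RectangleWindows.ThroughToolkit

local notation3 (prettyPrint := false) "Zs[" x ", " n ", " ℓ ", " a ", " b "]" =>
  (∑ s ∈ Finset.range ((ℓ + 1) * n + 1), (x : ℝ) ^ s * ((SAW.stripSAWs n ℓ s a b).card : ℝ))

local notation3 (prettyPrint := false) "Thr[" x ", " n ", " ℓ "]" =>
  (∑ s ∈ Finset.range ((ℓ + 1) * n + 1),
    (x : ℝ) ^ s * ((SAW.stripSAWs n ℓ s (![0, 1] : Site 2) (![((ℓ : ℕ) : ℤ), 1] : Site 2)).card : ℝ))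

-- All self-avoiding walks of the box `{0..ℓ} × {1..n}` from `a` to `b` (any length).
local notation3 (prettyPrint := false) "AS[" n ", " ℓ ", " a ", " b "]" =>
  ((Finset.range ((ℓ + 1) * n + 1)).biUnion fun s => SAW.stripSAWs n ℓ s a b)

-- The rotation by `π` of the box `{0..ℓ} × {1..n}`: `v ↦ (ℓ - v 0, n + 1 - v 1)`.
local notation3 (prettyPrint := false) "Rot[" ℓ ", " n "]" =>
  (RelIso.trans (zdSignedPermIso (Equiv.refl (Fin 2)) (fun _ => -1))
    (zdShiftIso (![((ℓ : ℕ) : ℤ), ((n : ℕ) : ℤ) + 1] : Site 2)) : zdGraph 2 ≃g zdGraph 2)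

/-! ## Coordinates and steps -/

/-- A unit step to the right is an edge of `ℤ²`. [folklore] -/
theorem adj_step_right (c r : ℤ) : (zdGraph 2).Adj (![c, r] : Site 2) ![c + 1, r] := by
  rw [zdGraph_adj_iff]
  refine ⟨0, Or.inl ?_⟩
  ext k; fin_cases k <;> simp

/-! ## The straight walk along a row -/

/-- The straight walk `(c, r) → (c + m, r)` of `m` steps to the right, with its support.
[folklore] -/
theorem exists_rowWalk (c r : ℤ) : ∀ m : ℕ,
    ∃ w : (zdGraph 2).Walk (![c, r] : Site 2) (![c + (m : ℤ), r] : Site 2),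
      w.length = m ∧ w.support = (List.range (m + 1)).map fun i : ℕ => (![c + (i : ℤ), r] : Site 2)
  | 0 => by
    refine ⟨(SimpleGraph.Walk.nil : (zdGraph 2).Walk (![c, r] : Site 2) ![c, r]).copy rfl ?_,
      ?_, ?_⟩
    · simp
    · simp
    · simp [List.range_succ]
  | m + 1 => by
    obtain ⟨w, hlen, hsupp⟩ := exists_rowWalk c r m
    refine ⟨(w.concat (adj_step_right (c + (m : ℤ)) r)).copy rfl ?_, ?_, ?_⟩
    · push_cast; rw [add_assoc]
    · simp [hlen]
    · rw [SimpleGraph.Walk.support_copy, SimpleGraph.Walk.support_concat, hsupp,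
        List.range_succ (n := m + 1), List.map_append, List.map_singleton]
      congr 2
      push_cast; rw [add_assoc]

/-- The straight bottom-row walk `(0,1) → (ℓ,1)` is an `ℓ`-step self-avoiding walk of the box
`{0..ℓ} × {1..n}` as soon as `n ≥ 1`. [folklore] -/
theorem exists_bottom_saw (n ℓ : ℕ) (hn : 1 ≤ n) :
    ∃ w : (zdGraph 2).Walk (![0, 1] : Site 2) (![((ℓ : ℕ) : ℤ), 1] : Site 2),
      w ∈ SAW.stripSAWs n ℓ ℓ (![0, 1] : Site 2) (![((ℓ : ℕ) : ℤ), 1] : Site 2) := by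
  obtain ⟨w, hlen, hsupp⟩ := exists_rowWalk 0 1 ℓ
  refine ⟨w.copy rfl (by simp), ?_⟩
  rw [SAW.mem_stripSAWs]
  refine ⟨by rw [SimpleGraph.Walk.length_copy, hlen], ?_, fun v hv => ?_⟩
  · rw [SimpleGraph.Walk.isPath_copy, SimpleGraph.Walk.isPath_def, hsupp]
    refine List.Nodup.map (fun i j hij => ?_) List.nodup_range
    have h0 := congrFun hij 0
    simpa using h0
  · rw [SimpleGraph.Walk.support_copy, hsupp, List.mem_map] at hv
    obtain ⟨i, hi, rfl⟩ := hv
    rw [List.mem_range] at hi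
    rw [SAW.mem_stripBox]
    simp only [Matrix.cons_val_zero, Matrix.cons_val_one, zero_add]
    omega

/-- **(T0)** The straight bottom-row walk: `x^ℓ ≤ Thr[x, n, ℓ]` for `x ≥ 0`, `n ≥ 1`. [folklore] -/
theorem pow_le_thr (x : ℝ) (n ℓ : ℕ) (hx : 0 ≤ x) (hn : 1 ≤ n) : x ^ ℓ ≤ Thr[x, n, ℓ] := by
  obtain ⟨w, hw⟩ := exists_bottom_saw n ℓ hn
  have hℓ : ℓ ∈ Finset.range ((ℓ + 1) * n + 1) := by
    rw [Finset.mem_range]; nlinarith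
  have hcard : (1 : ℝ) ≤
      ((SAW.stripSAWs n ℓ ℓ (![0, 1] : Site 2) (![((ℓ : ℕ) : ℤ), 1] : Site 2)).card : ℝ) := by
    exact_mod_cast Finset.card_pos.2 ⟨w, hw⟩
  calc x ^ ℓ ≤ x ^ ℓ * ((SAW.stripSAWs n ℓ ℓ (![0, 1] : Site 2) (![((ℓ : ℕ) : ℤ), 1] : Site 2)).card : ℝ) :=
        le_mul_of_one_le_right (pow_nonneg hx _) hcard
    _ ≤ Thr[x, n, ℓ] :=
        Finset.single_le_sum (f := fun s => x ^ s *
            ((SAW.stripSAWs n ℓ s (![0, 1] : Site 2) (![((ℓ : ℕ) : ℤ), 1] : Site 2)).card : ℝ))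
          (fun s _ => mul_nonneg (pow_nonneg hx _) (Nat.cast_nonneg _)) hℓ

/-! ## Sums over all self-avoiding walks of the box -/

/-- Membership in the set of all SAWs of the box: self-avoiding and inside the box (the length
bound is automatic). [folklore] -/
theorem mem_allSAWs {n ℓ : ℕ} {a b : Site 2} {p : (zdGraph 2).Walk a b} :
    p ∈ AS[n, ℓ, a, b] ↔ p.IsPath ∧ ∀ v ∈ p.support, v ∈ SAW.stripBox n ℓ := by
  simp only [Finset.mem_biUnion, Finset.mem_range, SAW.mem_stripSAWs]
  constructor
  · rintro ⟨s, -, -, hpath, hbox⟩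
    exact ⟨hpath, hbox⟩
  · rintro ⟨hpath, hbox⟩
    have hmem : p ∈ SAW.stripSAWs n ℓ p.length a b := SAW.mem_stripSAWs.2 ⟨rfl, hpath, hbox⟩
    exact ⟨p.length, Nat.lt_succ_of_lt (SAW.lt_of_mem_stripSAWs hmem), rfl, hpath, hbox⟩

/-- The box partition function as a sum of `x^{|ω|}` over all SAWs `ω` of the box. [folklore] -/
theorem zs_eq_sum_allSAWs (x : ℝ) (n ℓ : ℕ) (a b : Site 2) :
    Zs[x, n, ℓ, a, b] = ∑ p ∈ AS[n, ℓ, a, b], x ^ p.length := by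
  rw [Finset.sum_biUnion]
  · refine Finset.sum_congr rfl fun s _ => ?_
    have h : ∑ p ∈ SAW.stripSAWs n ℓ s a b, x ^ p.length =
        ∑ p ∈ SAW.stripSAWs n ℓ s a b, x ^ s :=
      Finset.sum_congr rfl fun p hp => by rw [(SAW.mem_stripSAWs.1 hp).1]
    rw [h, Finset.sum_const, nsmul_eq_mul, mul_comm]
  · intro s _ t _ hst
    exact Finset.disjoint_left.2 fun p hps hpt =>
      hst ((SAW.mem_stripSAWs.1 hps).1.symm.trans (SAW.mem_stripSAWs.1 hpt).1)

/-- In the box of width `0` there are no walks at all: `Zs[x, 0, ℓ, a, b] = 0`. [folklore] -/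
theorem zs_width_zero (x : ℝ) (ℓ : ℕ) (a b : Site 2) : Zs[x, 0, ℓ, a, b] = 0 :=
  Finset.sum_eq_zero fun s _ => by
    rw [SAW.stripSAWs_eq_empty (by simp) a b, Finset.card_empty, Nat.cast_zero, mul_zero]

/-- **Weighted injections on pairs.** If `g` glues a pair of SAWs of two boxes injectively into a
SAW of a third box, adding `k` steps, then `x^k · Zs₁ · Zs₂ ≤ Zs₃` for `x ≥ 0`. [folklore] -/
theorem mul_zs_mul_zs_le {x : ℝ} (hx : 0 ≤ x) (k : ℕ) {n₁ ℓ₁ n₂ ℓ₂ n₃ ℓ₃ : ℕ}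
    {a₁ b₁ a₂ b₂ a₃ b₃ : Site 2}
    (g : (zdGraph 2).Walk a₁ b₁ × (zdGraph 2).Walk a₂ b₂ → (zdGraph 2).Walk a₃ b₃)
    (hmem : ∀ pq ∈ AS[n₁, ℓ₁, a₁, b₁] ×ˢ AS[n₂, ℓ₂, a₂, b₂], g pq ∈ AS[n₃, ℓ₃, a₃, b₃])
    (hlen : ∀ pq ∈ AS[n₁, ℓ₁, a₁, b₁] ×ˢ AS[n₂, ℓ₂, a₂, b₂],
      (g pq).length = pq.1.length + pq.2.length + k)
    (hinj : Set.InjOn g ↑(AS[n₁, ℓ₁, a₁, b₁] ×ˢ AS[n₂, ℓ₂, a₂, b₂])) :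
    x ^ k * Zs[x, n₁, ℓ₁, a₁, b₁] * Zs[x, n₂, ℓ₂, a₂, b₂] ≤ Zs[x, n₃, ℓ₃, a₃, b₃] := by
  rw [zs_eq_sum_allSAWs, zs_eq_sum_allSAWs, zs_eq_sum_allSAWs, mul_assoc, Finset.sum_mul_sum,
    ← Finset.sum_product', Finset.mul_sum]
  calc ∑ pq ∈ AS[n₁, ℓ₁, a₁, b₁] ×ˢ AS[n₂, ℓ₂, a₂, b₂],
        x ^ k * (x ^ pq.1.length * x ^ pq.2.length)
      = ∑ pq ∈ AS[n₁, ℓ₁, a₁, b₁] ×ˢ AS[n₂, ℓ₂, a₂, b₂], x ^ (g pq).length :=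
        Finset.sum_congr rfl fun pq hpq => by rw [hlen pq hpq, pow_add, pow_add]; ring
    _ = ∑ w ∈ (AS[n₁, ℓ₁, a₁, b₁] ×ˢ AS[n₂, ℓ₂, a₂, b₂]).image g, x ^ w.length := by
        rw [Finset.sum_image hinj]
    _ ≤ ∑ w ∈ AS[n₃, ℓ₃, a₃, b₃], x ^ w.length :=
        Finset.sum_le_sum_of_subset_of_nonneg (Finset.image_subset_iff.2 hmem)
          fun w _ _ => pow_nonneg hx _

/-! ## (T2) Concatenation through one horizontal step -/

/-- A list identity: if `l₁ ++ l₂ = m₁ ++ m₂` where `l₁, m₁` satisfy `P` termwise and `l₂, m₂`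
violate it termwise, then `l₁ = m₁` and `l₂ = m₂`. [folklore] -/
theorem append_inj_of_forall {α : Type*} {l₁ l₂ m₁ m₂ : List α} (P : α → Prop) [DecidablePred P]
    (h : l₁ ++ l₂ = m₁ ++ m₂) (hl₁ : ∀ a ∈ l₁, P a) (hl₂ : ∀ a ∈ l₂, ¬P a)
    (hm₁ : ∀ a ∈ m₁, P a) (hm₂ : ∀ a ∈ m₂, ¬P a) : l₁ = m₁ ∧ l₂ = m₂ := by
  have key : ∀ {u₁ u₂ : List α}, (∀ a ∈ u₁, P a) → (∀ a ∈ u₂, ¬P a) →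
      (u₁ ++ u₂).filter (fun a => decide (P a)) = u₁ := by
    intro u₁ u₂ h₁ h₂
    rw [List.filter_append, List.filter_eq_self.2 (by simpa using h₁),
      List.filter_eq_nil_iff.2 (by simpa using h₂), List.append_nil]
  have h1 : l₁ = m₁ := by rw [← key hl₁ hl₂, h, key hm₁ hm₂]
  subst h1
  exact ⟨rfl, List.append_cancel_left h⟩

/-- Support of the glued walk `γ · (b → c) · (δ + t)`: the support of `γ` followed by the
translated support of `δ`. [folklore] -/
theorem support_glue {a b c a' b' d : Site 2} (γ : (zdGraph 2).Walk a b) (h : (zdGraph 2).Adj b c)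
    (δ : (zdGraph 2).Walk a' b') (t : Site 2) (hs : zdShiftIso t a' = c)
    (he : zdShiftIso t b' = d) :
    (γ.append (SimpleGraph.Walk.cons h ((δ.map (zdShiftIso t).toHom).copy hs he))).support =
      γ.support ++ δ.support.map fun u => u + t := by
  rw [SimpleGraph.Walk.support_append, SimpleGraph.Walk.support_cons, List.tail_cons,
    SimpleGraph.Walk.support_copy, SimpleGraph.Walk.support_map]
  rfl

/-- Length of the glued walk `γ · (b → c) · (δ + t)`: `|γ| + |δ| + 1`. [folklore] -/
theorem length_glue {a b c a' b' d : Site 2} (γ : (zdGraph 2).Walk a b) (h : (zdGraph 2).Adj b c)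
    (δ : (zdGraph 2).Walk a' b') (t : Site 2) (hs : zdShiftIso t a' = c)
    (he : zdShiftIso t b' = d) :
    (γ.append (SimpleGraph.Walk.cons h ((δ.map (zdShiftIso t).toHom).copy hs he))).length =
      γ.length + δ.length + 1 := by
  rw [SimpleGraph.Walk.length_append, SimpleGraph.Walk.length_cons,
    SimpleGraph.Walk.length_copy, SimpleGraph.Walk.length_map, add_assoc]

/-- **(T2)** Supermultiplicativity of `ℓ ↦ x · Thr[x, n, ℓ]`:
`x · Thr[p] · Thr[q] ≤ Thr[p + q + 1]` for `x ≥ 0`, by concatenating a through walk of span `p`,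
the step `(p,1) → (p+1,1)` and a through walk of span `q` translated by `(p+1, 0)`. [folklore] -/
theorem thr_supermul (x : ℝ) (n p q : ℕ) (hx : 0 ≤ x) :
    x * Thr[x, n, p] * Thr[x, n, q] ≤ Thr[x, n, p + q + 1] := by
  have hadj : (zdGraph 2).Adj (![(p : ℤ), 1] : Site 2) ![(p : ℤ) + 1, 1] := adj_step_right _ _
  obtain ⟨t, ht⟩ : ∃ t : Site 2, t = ![(p : ℤ) + 1, 0] := ⟨_, rfl⟩
  have ht0 : t 0 = (p : ℤ) + 1 := by rw [ht]; rfl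
  have ht1 : t 1 = 0 := by rw [ht]; rfl
  have hs : zdShiftIso t (![0, 1] : Site 2) = ![(p : ℤ) + 1, 1] := by
    rw [zdShiftIso_apply]; ext i; fin_cases i <;> simp [ht0, ht1]
  have he : zdShiftIso t (![((q : ℕ) : ℤ), 1] : Site 2) = ![((p + q + 1 : ℕ) : ℤ), 1] := by
    rw [zdShiftIso_apply]; ext i; fin_cases i <;> (simp [ht0, ht1]; try omega)
  -- column bounds: `γ` lives in columns `≤ p`, the translate of `δ` in columns `≥ p + 1`
  have hcolL : ∀ {m : ℕ} {γ : (zdGraph 2).Walk (![0, 1] : Site 2) (![((p : ℕ) : ℤ), 1] : Site 2)},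
      γ ∈ AS[n, p, (![0, 1] : Site 2), (![((p : ℕ) : ℤ), 1] : Site 2)] → m = m →
      ∀ w ∈ γ.support, w 0 ≤ (p : ℤ) :=
    fun hγ _ w hw => (SAW.mem_stripBox.1 ((mem_allSAWs.1 hγ).2 w hw)).2.1
  have hcolR : ∀ {δ : (zdGraph 2).Walk (![0, 1] : Site 2) (![((q : ℕ) : ℤ), 1] : Site 2)},
      δ ∈ AS[n, q, (![0, 1] : Site 2), (![((q : ℕ) : ℤ), 1] : Site 2)] →
      ∀ w ∈ δ.support.map (fun u => u + t), ¬(w 0 ≤ (p : ℤ)) := by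
    intro δ hδ w hw
    rw [List.mem_map] at hw
    obtain ⟨u, hu, rfl⟩ := hw
    have h0 := (SAW.mem_stripBox.1 ((mem_allSAWs.1 hδ).2 u hu)).1
    rw [Pi.add_apply, ht0]
    omega
  have key := mul_zs_mul_zs_le hx 1 (n₁ := n) (ℓ₁ := p) (n₂ := n) (ℓ₂ := q) (n₃ := n)
    (ℓ₃ := p + q + 1)
    (fun pq : (zdGraph 2).Walk (![0, 1] : Site 2) (![((p : ℕ) : ℤ), 1] : Site 2) ×
        (zdGraph 2).Walk (![0, 1] : Site 2) (![((q : ℕ) : ℤ), 1] : Site 2) =>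
      pq.1.append (SimpleGraph.Walk.cons hadj ((pq.2.map (zdShiftIso t).toHom).copy hs he)))
    ?_ ?_ ?_
  · rw [pow_one] at key
    exact key
  · -- the glued walk is a SAW of the big box
    rintro ⟨γ, δ⟩ hpq
    rw [Finset.mem_product] at hpq
    obtain ⟨hγ, hδ⟩ := hpq
    obtain ⟨hγp, hγb⟩ := mem_allSAWs.1 hγ
    obtain ⟨hδp, hδb⟩ := mem_allSAWs.1 hδ
    rw [mem_allSAWs]
    have hsupp := support_glue γ hadj δ t hs he
    refine ⟨?_, fun w hw => ?_⟩
    · rw [SimpleGraph.Walk.isPath_def, hsupp]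
      refine hγp.support_nodup.append (hδp.support_nodup.map (add_left_injective t)) ?_
      intro w hw1 hw2
      exact hcolR hδ w hw2 (hcolL hγ (rfl : 0 = 0) w hw1)
    · rw [hsupp, List.mem_append] at hw
      rcases hw with hw | hw
      · have hb := SAW.mem_stripBox.1 (hγb w hw)
        rw [SAW.mem_stripBox]
        refine ⟨hb.1, ?_, hb.2.2.1, hb.2.2.2⟩
        have := hb.2.1
        push_cast
        omega
      · rw [List.mem_map] at hw
        obtain ⟨u, hu, rfl⟩ := hw
        have hb := SAW.mem_stripBox.1 (hδb u hu)
        rw [SAW.mem_stripBox]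
        simp only [Pi.add_apply, ht0, ht1]
        push_cast
        omega
  · -- lengths add, plus one step
    rintro ⟨γ, δ⟩ -
    exact length_glue γ hadj δ t hs he
  · -- injectivity: split the support at the column `p | p + 1`
    rintro ⟨γ, δ⟩ hpq ⟨γ', δ'⟩ hpq' h
    rw [Finset.coe_product, Set.mem_prod, Finset.mem_coe, Finset.mem_coe] at hpq hpq'
    have hsup := congrArg SimpleGraph.Walk.support h
    simp only [support_glue] at hsup
    obtain ⟨h1, h2⟩ := append_inj_of_forall (fun w : Site 2 => w 0 ≤ (p : ℤ)) hsup
      (hcolL hpq.1 (rfl : 0 = 0)) (hcolR hpq.2) (hcolL hpq'.1 (rfl : 0 = 0)) (hcolR hpq'.2)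
    rw [SimpleGraph.Walk.ext_support h1,
      SimpleGraph.Walk.ext_support ((List.map_injective_iff.2 (add_left_injective t)) h2)]

/-- **(T3)** Extension by one step: `x · Thr[p] ≤ Thr[p + 1]` for `x ≥ 0` ((T2) with `q = 0`
and the trivial walk; for `n = 0` both sides vanish). [folklore] -/
theorem thr_step (x : ℝ) (n p : ℕ) (hx : 0 ≤ x) : x * Thr[x, n, p] ≤ Thr[x, n, p + 1] := by
  rcases Nat.eq_zero_or_pos n with rfl | hn
  · rw [zs_width_zero, zs_width_zero, mul_zero]
  · have h2 := thr_supermul x n p 0 hx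
    have h0 := pow_le_thr x n 0 hx hn
    rw [pow_zero] at h0
    rw [Nat.add_zero] at h2
    have hT : 0 ≤ x * Thr[x, n, p] :=
      mul_nonneg hx (Finset.sum_nonneg fun s _ => mul_nonneg (pow_nonneg hx _) (Nat.cast_nonneg _))
    calc x * Thr[x, n, p] = x * Thr[x, n, p] * 1 := (mul_one _).symm
      _ ≤ x * Thr[x, n, p] * Thr[x, n, 0] := mul_le_mul_of_nonneg_left h0 hT
      _ ≤ Thr[x, n, p + 1] := h2

/-! ## (T5) Rotation by `π` -/

/-- Transport of SAWs of the box along a graph automorphism of `ℤ²` preserving the box: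
`#SAWs(a → b) ≤ #SAWs(φ a → φ b)` at every length. [folklore] -/
theorem card_stripSAWs_le_of_iso {n ℓ : ℕ} (s : ℕ) {a b c d : Site 2} (φ : zdGraph 2 ≃g zdGraph 2)
    (hbox : ∀ v ∈ SAW.stripBox n ℓ, φ v ∈ SAW.stripBox n ℓ) (ha : φ a = c) (hb : φ b = d) :
    (SAW.stripSAWs n ℓ s a b).card ≤ (SAW.stripSAWs n ℓ s c d).card := by
  refine Finset.card_le_card_of_injOn (fun w => (w.map φ.toHom).copy ha hb) ?_ ?_
  · intro w hw
    rw [Finset.mem_coe, SAW.mem_stripSAWs] at hw ⊢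
    obtain ⟨hlen, hpath, hbx⟩ := hw
    refine ⟨by rw [SimpleGraph.Walk.length_copy, SimpleGraph.Walk.length_map, hlen], ?_,
      fun v hv => ?_⟩
    · rw [SimpleGraph.Walk.isPath_copy]
      exact hpath.map φ.injective
    · rw [SimpleGraph.Walk.support_copy, SimpleGraph.Walk.support_map, List.mem_map] at hv
      obtain ⟨u, hu, rfl⟩ := hv
      exact hbox u (hbx u hu)
  · intro w _ w' _ h
    have h' := congrArg (fun z => z.copy ha.symm hb.symm) h
    simp only [SimpleGraph.Walk.copy_copy, SimpleGraph.Walk.copy_rfl_rfl] at h'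
    exact SimpleGraph.Walk.map_injective_of_injective φ.injective _ _ h'

/-- The rotation by `π` in coordinates: `Rot (c, r) = (ℓ - c, n + 1 - r)`. [folklore] -/
theorem rot_apply (ℓ n : ℕ) (v : Site 2) :
    Rot[ℓ, n] v = ![(ℓ : ℤ) - v 0, (n : ℤ) + 1 - v 1] := by
  ext i
  fin_cases i <;> simp <;> ring

/-- The rotation by `π` maps the box `{0..ℓ} × {1..n}` into itself. [folklore] -/
theorem rot_mem_stripBox {n ℓ : ℕ} (v : Site 2) (hv : v ∈ SAW.stripBox n ℓ) :
    Rot[ℓ, n] v ∈ SAW.stripBox n ℓ := by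
  rw [SAW.mem_stripBox] at hv ⊢
  rw [rot_apply]
  simp only [Matrix.cons_val_zero, Matrix.cons_val_one]
  omega

/-- **(T5), counted.** The rotation by `π` is a length-preserving bijection between the SAWs
`BR → TR` and the SAWs `TL → BL` of the box. [folklore] -/
theorem card_stripSAWs_rot (n ℓ s : ℕ) :
    (SAW.stripSAWs n ℓ s (![(ℓ : ℤ), 1] : Site 2) (![(ℓ : ℤ), (n : ℤ)] : Site 2)).card =
      (SAW.stripSAWs n ℓ s (![0, (n : ℤ)] : Site 2) (![0, 1] : Site 2)).card := by
  refine le_antisymm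
    (card_stripSAWs_le_of_iso s Rot[ℓ, n] rot_mem_stripBox ?_ ?_)
    (card_stripSAWs_le_of_iso s Rot[ℓ, n] rot_mem_stripBox ?_ ?_) <;>
  · rw [rot_apply]; ext i; fin_cases i <;> simp

/-- **(T5)** Rotation symmetry of the box: `Z(BR → TR) = Z(TL → BL)`. [folklore] -/
theorem zs_rot (x : ℝ) (n ℓ : ℕ) :
    Zs[x, n, ℓ, ![(ℓ : ℤ), 1], ![(ℓ : ℤ), (n : ℤ)]] = Zs[x, n, ℓ, ![0, (n : ℤ)], ![0, 1]] :=
  Finset.sum_congr rfl fun s _ => by rw [card_stripSAWs_rot n ℓ s]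

/-! ## The registered stub -/

/-- **T-A · through toolkit** (walk surgery on `SAW.stripSAWs`; every item is one explicit
injective length-additive map, or a bijection).
(T0) the straight bottom-row walk: `x^ℓ ≤ Thr[x,n,ℓ]` (`n ≥ 1`);
(T2) concatenation through one horizontal step `(p,1) → (p+1,1)` of a through walk of span `p`
and a translated through walk of span `q`: `x · Thr[p] · Thr[q] ≤ Thr[p+q+1]`;
(T3) extension by one step: `x · Thr[p] ≤ Thr[p+1]`;
(T5) rotation by `π` of the box (`(c,r) ↦ (ℓ-c, n+1-r)`, a graph automorphism of `ℤ²` preserving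
the box and lengths): `Z(BR→TR) = Z(TL→BL)`. [folklore] -/
theorem stub_throughToolkit :
    (∀ (x : ℝ) (n ℓ : ℕ), 0 ≤ x → 1 ≤ n → x ^ ℓ ≤ Thr[x, n, ℓ]) ∧
    (∀ (x : ℝ) (n p q : ℕ), 0 ≤ x → x * Thr[x, n, p] * Thr[x, n, q] ≤ Thr[x, n, p + q + 1]) ∧
    (∀ (x : ℝ) (n p : ℕ), 0 ≤ x → x * Thr[x, n, p] ≤ Thr[x, n, p + 1]) ∧
    (∀ (x : ℝ) (n ℓ : ℕ),
      Zs[x, n, ℓ, ![(ℓ : ℤ), 1], ![(ℓ : ℤ), (n : ℤ)]] = Zs[x, n, ℓ, ![0, (n : ℤ)], ![0, 1]]) :=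
  ⟨pow_le_thr, thr_supermul, thr_step, zs_rot⟩

end Summit.CriticalPhenomena.SAWScalingLimit.Theorems.EdgeOfPositivity.RectangleWindows.ThroughToolkit

end
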